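import Summits.AtomisticToContinuum.HydrodynamicLimit.Theses.AntiMazurCoboundaries
import Literature.MathematicalPhysics.KineticTheory.HardSphereEulerProofs

/-!
# The discrete Fejér corrector (stub 6)

Helper file (`--supports stmt-AtomisticToContinuum-14135`) proving the registered stub `stub_discreteFejerCorrector` of the lead's skeleton
`Cruxes/CorrectorPressureDecay/Lines/kinetic-entropy-collision-budget.lean` (line `kinetic-entropy-collision-budget`) of
the crux `Summit.AtomisticToContinuum.HydrodynamicLimit.Theses.AntiMazurCoboundaries.CorrectorPressureDecay`
(stmt-AtomisticToContinuum-14135, route `AntiMazurCoboundaries`). The statement is spelled over tree primitives exactly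
as registered; see the skeleton for the objects it abbreviates (`discAvg`, `optimiser`, `windowOneBodyLaw`, `condKL`,
`fastDev`).

Proof summary. For the one-body observable `F z = Σᵢ φ(xᵢ) g((vᵢ − u₀)/√θ)` the corrector is the discrete
Fejér sum `W z = −(lag/n) Σ_{k<n} (n − k) F(Φ_{k·lag} z)`.
* `abel_fejer` / `fejer_corrector_identity`: the summation by parts
  `Σ_{k<n} (n − k)(a_{k+1} − a_k) = Σ_{j<n} a_{j+1} − n a_0`, hence
  `a_0 − lag⁻¹((−(lag/n) Σ (n−k) a_{k+1}) − (−(lag/n) Σ (n−k) a_k)) = n⁻¹ Σ_{j<n} a_{j+1}`.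
* `corrector_identity_of_flow`: with `a_k = F(Φ_{k·lag} z)`, `Φ_0 z = z` and
  `Φ_{k·lag}(Φ_lag z) = Φ_{(k+1)lag} z` (valid on the good set), `F z − lag⁻¹(W(Φ_lag z) − W z)` is the
  discrete window average `n⁻¹ Σ_{j<n} F(Φ_{(j+1)lag} z)`.
* `discreteFejer_of_window`: abstract measure-theoretic form — for a flow with a conull good set and a
  probability measure, the DEFECT integral equals the window-average moment (`lintegral_congr_ae`), and
  `|W| ≤ lag·n·K` pointwise (`|F| ≤ K`), so `4ℓ⁻¹|W| ≤ E` once `4K(n·lag) ≤ Eℓ`, whence the COST bound.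
* `stub_discreteFejerCorrector`: instantiate with `G_N` (a probability measure by
  `isProbabilityMeasure_localGibbsLaw`, `G_N ≪ liouville` by `localGibbsMeasure_absolutelyContinuous`, so the
  good set is `G_N`-conull), `K = (N+1)κ`, `E = δ(N+1)`, `ℓ = τ₀ ℓ_N`.
-/

noncomputable section

open MeasureTheory ProbabilityTheory InformationTheory Set Filter Topology
open scoped ENNReal

namespace Summit.AtomisticToContinuum.HydrodynamicLimit.Theorems.KineticEntropyCollisionBudget

open Literature.MathematicalPhysics.KineticTheory (T3 V3 hsDiameter localGibbsLaw)
open Literature.MathematicalPhysics.KineticTheory (localGibbsLaw_eq localGibbsMeasure_absolutelyContinuous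
  isProbabilityMeasure_localGibbsLaw)
open Literature.Analysis.FluidPDE (HardSphereFlow Config)

/-- **Abel / Fejér summation by parts.** For every real sequence `a`, every `c` and every `n`,
`Σ_{k<n} (c − k)(a_{k+1} − a_k) = c (a_n − a_0) − n a_n + Σ_{j<n} a_{j+1}`. [folklore] -/
theorem abel_fejer (a : ℕ → ℝ) (c : ℝ) (n : ℕ) :
    ∑ k ∈ Finset.range n, (c - k) * (a (k + 1) - a k) =
      c * (a n - a 0) - n * a n + ∑ j ∈ Finset.range n, a (j + 1) := by
  induction n with
  | zero => simp
  | succ n ih =>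
    rw [Finset.sum_range_succ, Finset.sum_range_succ (fun j => a (j + 1)), ih]
    push_cast
    ring

/-- **The discrete Fejér corrector identity for a sequence** (`1 ≤ n`, `lag ≠ 0`):
`a_0 − lag⁻¹((−(lag/n) Σ_{k<n} (n − k) a_{k+1}) − (−(lag/n) Σ_{k<n} (n − k) a_k)) = n⁻¹ Σ_{j<n} a_{j+1}`.
[folklore] -/
theorem fejer_corrector_identity (a : ℕ → ℝ) {n : ℕ} (hn : 1 ≤ n) {lag : ℝ} (hlag : lag ≠ 0) :
    a 0 - lag⁻¹ * ((-(lag / n) * ∑ k ∈ Finset.range n, ((n : ℝ) - k) * a (k + 1)) -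
        (-(lag / n) * ∑ k ∈ Finset.range n, ((n : ℝ) - k) * a k)) =
      (n : ℝ)⁻¹ * ∑ j ∈ Finset.range n, a (j + 1) := by
  have hn' : (n : ℝ) ≠ 0 := Nat.cast_ne_zero.mpr (Nat.one_le_iff_ne_zero.mp hn)
  have key : ∑ k ∈ Finset.range n, ((n : ℝ) - k) * a (k + 1) =
      ∑ k ∈ Finset.range n, ((n : ℝ) - k) * a k + (∑ j ∈ Finset.range n, a (j + 1) - n * a 0) := by
    rw [← sub_eq_iff_eq_add', ← Finset.sum_sub_distrib]
    simp_rw [← mul_sub]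
    rw [abel_fejer a n n]
    ring
  rw [key]
  field_simp
  ring

/-- **The corrector identity along a flow.** If `Φ_0 z = z` and `Φ_{k·lag}(Φ_lag z) = Φ_{(k+1)·lag} z`
for all `k`, then with `W = −(lag/n) Σ_{k<n} (n − k) F∘Φ_{k·lag}` one has
`F z − lag⁻¹ (W (Φ_lag z) − W z) = n⁻¹ Σ_{j<n} F (Φ_{(j+1)·lag} z)`. [folklore] -/
theorem corrector_identity_of_flow {X : Type*} (flow : ℝ → X → X) (F : X → ℝ) {z : X} {lag : ℝ}
    (h0 : flow 0 z = z)
    (hadd : ∀ k : ℕ, flow ((k : ℝ) * lag) (flow lag z) = flow (((k : ℝ) + 1) * lag) z)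
    {n : ℕ} (hn : 1 ≤ n) (hlag : lag ≠ 0) :
    F z - lag⁻¹ *
        ((-(lag / n) * ∑ k ∈ Finset.range n, ((n : ℝ) - k) * F (flow ((k : ℝ) * lag) (flow lag z))) -
          (-(lag / n) * ∑ k ∈ Finset.range n, ((n : ℝ) - k) * F (flow ((k : ℝ) * lag) z))) =
      (n : ℝ)⁻¹ * ∑ j : Fin n, F (flow ((((j : ℕ) : ℝ) + 1) * lag) z) := by
  have h := fejer_corrector_identity (fun k => F (flow ((k : ℝ) * lag) z)) hn hlag
  simp only [Nat.cast_zero, zero_mul, h0, Nat.cast_add, Nat.cast_one] at h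
  simp_rw [hadd]
  rw [Fin.sum_univ_eq_sum_range (fun j => F (flow ((((j : ℕ) : ℝ) + 1) * lag) z)) n]
  exact h

/-- **The discrete Fejér corrector, abstract form.** For a measurable flow with a group law on a
`μ`-conull good set (`μ` a probability measure), a measurable observable `F` with `|F| ≤ K`, `1 ≤ n`,
`lag, ℓ > 0` and `4K(n·lag) ≤ Eℓ`: the corrector `W = −(lag/n) Σ_{k<n} (n − k) F∘Φ_{k·lag}` is measurable
and bounded, its defect integral `∫ exp(2(F − lag⁻¹(W∘Φ_lag − W))) dμ` equals the discrete-window moment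
`∫ exp(2 n⁻¹ Σ_{j<n} F∘Φ_{(j+1)lag}) dμ`, and `∫ exp(4ℓ⁻¹|W|) dμ ≤ e^E`. [folklore] -/
theorem discreteFejer_of_window {X : Type*} [MeasurableSpace X] (flow : ℝ → X → X)
    (hflow : ∀ t, Measurable (flow t)) (good : Set X) (h0 : ∀ z ∈ good, flow 0 z = z)
    (hadd : ∀ s t, ∀ z ∈ good, flow (s + t) z = flow s (flow t z))
    (μ : Measure X) [IsProbabilityMeasure μ] (hμ : ∀ᵐ z ∂μ, z ∈ good)
    (F : X → ℝ) (hFm : Measurable F) {K : ℝ} (hFK : ∀ z, |F z| ≤ K)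
    {n : ℕ} (hn : 1 ≤ n) {lag ℓ E : ℝ} (hlag : 0 < lag) (hℓ : 0 < ℓ)
    (hcost : 4 * K * ((n : ℝ) * lag) ≤ E * ℓ) {B : ℝ≥0∞}
    (hmom : ∫⁻ z, ENNReal.ofReal (Real.exp (2 * ((n : ℝ)⁻¹ *
      ∑ j : Fin n, F (flow ((((j : ℕ) : ℝ) + 1) * lag) z)))) ∂μ ≤ B) :
    ∃ W : X → ℝ, Measurable W ∧ (∃ C : ℝ, ∀ z, |W z| ≤ C) ∧
      ∫⁻ z, ENNReal.ofReal (Real.exp (2 * (F z - lag⁻¹ * (W (flow lag z) - W z)))) ∂μ ≤ B ∧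
      ∫⁻ z, ENNReal.ofReal (Real.exp (4 * ℓ⁻¹ * |W z|)) ∂μ ≤ ENNReal.ofReal (Real.exp E) := by
  have hn0 : (0 : ℝ) < n := Nat.cast_pos.mpr (by omega)
  -- the pointwise bound `|W z| ≤ lag · n · K`
  have hWbd : ∀ z, |-(lag / n) * ∑ k ∈ Finset.range n, ((n : ℝ) - k) * F (flow ((k : ℝ) * lag) z)|
      ≤ lag * (n * K) := by
    intro z
    rw [abs_mul, abs_neg, abs_of_pos (div_pos hlag hn0)]
    have hsum : |∑ k ∈ Finset.range n, ((n : ℝ) - k) * F (flow ((k : ℝ) * lag) z)| ≤ n * (n * K) :=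
      calc |∑ k ∈ Finset.range n, ((n : ℝ) - k) * F (flow ((k : ℝ) * lag) z)|
          ≤ ∑ k ∈ Finset.range n, |((n : ℝ) - k) * F (flow ((k : ℝ) * lag) z)| :=
            Finset.abs_sum_le_sum_abs _ _
        _ ≤ ∑ _k ∈ Finset.range n, (n : ℝ) * K := Finset.sum_le_sum fun k hk => by
            rw [abs_mul]
            have hk : (k : ℝ) < n := Nat.cast_lt.mpr (Finset.mem_range.mp hk)
            have h1 : |(n : ℝ) - k| ≤ n := by
              rw [abs_of_nonneg (sub_nonneg.mpr hk.le)]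
              exact sub_le_self _ (Nat.cast_nonneg k)
            exact mul_le_mul h1 (hFK _) (abs_nonneg _) hn0.le
        _ = n * (n * K) := by rw [Finset.sum_const, Finset.card_range, nsmul_eq_mul]
    calc lag / n * |∑ k ∈ Finset.range n, ((n : ℝ) - k) * F (flow ((k : ℝ) * lag) z)|
        ≤ lag / n * (n * (n * K)) := mul_le_mul_of_nonneg_left hsum (div_pos hlag hn0).le
      _ = lag * (n * K) := by field_simp
  -- the pointwise cost bound `4 ℓ⁻¹ |W z| ≤ E`
  have hcostpt : ∀ z, 4 * ℓ⁻¹ *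
      |-(lag / n) * ∑ k ∈ Finset.range n, ((n : ℝ) - k) * F (flow ((k : ℝ) * lag) z)| ≤ E := by
    intro z
    refine (mul_le_mul_of_nonneg_left (hWbd z) (mul_nonneg (by norm_num) (inv_nonneg.mpr hℓ.le))).trans ?_
    calc 4 * ℓ⁻¹ * (lag * (n * K)) = ℓ⁻¹ * (4 * K * ((n : ℝ) * lag)) := by ring
      _ ≤ ℓ⁻¹ * (E * ℓ) := mul_le_mul_of_nonneg_left hcost (inv_nonneg.mpr hℓ.le)
      _ = E := by rw [mul_comm E, ← mul_assoc, inv_mul_cancel₀ hℓ.ne', one_mul]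
  refine ⟨fun z => -(lag / n) * ∑ k ∈ Finset.range n, ((n : ℝ) - k) * F (flow ((k : ℝ) * lag) z),
    ?_, ⟨lag * (n * K), hWbd⟩, ?_, ?_⟩
  · -- measurability
    exact (Finset.measurable_sum _ fun k _ => (hFm.comp (hflow _)).const_mul _).const_mul _
  · -- defect: the a.e. identity `F − lag⁻¹(W∘Φ_lag − W) = n⁻¹ Σ_{j<n} F∘Φ_{(j+1)lag}`
    refine ((lintegral_congr_ae ?_).trans_le hmom)
    filter_upwards [hμ] with z hz
    have hadd' : ∀ k : ℕ, flow ((k : ℝ) * lag) (flow lag z) = flow (((k : ℝ) + 1) * lag) z := by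
      intro k
      rw [← hadd _ _ z hz, add_one_mul]
    rw [corrector_identity_of_flow flow F (h0 z hz) hadd' hn hlag.ne']
  · -- cost
    calc ∫⁻ z, ENNReal.ofReal (Real.exp (4 * ℓ⁻¹ *
            |-(lag / n) * ∑ k ∈ Finset.range n, ((n : ℝ) - k) * F (flow ((k : ℝ) * lag) z)|)) ∂μ
        ≤ ∫⁻ _, ENNReal.ofReal (Real.exp E) ∂μ :=
          lintegral_mono fun z => ENNReal.ofReal_le_ofReal (Real.exp_le_exp.mpr (hcostpt z))
      _ = ENNReal.ofReal (Real.exp E) := by rw [lintegral_const, measure_univ, mul_one]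

/-- **Registered stub `stub_discreteFejerCorrector`** (line `kinetic-entropy-collision-budget`, crux stmt-AtomisticToContinuum-14135): if `4κ·(n·lag) ≤ δ·τ₀ℓ_N` and the discrete-window exponential moment is `≤ e^{δ(N+1)}`, the discrete Fejér corrector `W = −lag Σ_{k<n}(1 − k/n) F∘Φ_{k·lag}` satisfies both clauses (defect and cost) of `CorrectorPressureDecay` at this `lag`. -/
theorem stub_discreteFejerCorrector :
    ∀ (σ a θ : ℝ) (u₀ : V3), 0 < σ → σ ≤ 1 / 2 → 0 < a → 0 < θ →
      ∀ (N : ℕ) (Φ : HardSphereFlow (Literature.Analysis.FluidPDE.Torus.geometry (Fin 3)) (hsDiameter σ N) (N + 1)) (φ : T3 → ℝ) (g : V3 → ℝ) (κ : ℝ),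
        Continuous φ → Continuous g → (∀ x, |φ x| ≤ 1) → (∀ v, |g v| ≤ κ) →
        ∀ (n : ℕ) (lag δ τ₀ : ℝ), 1 ≤ n → 0 < lag → 0 < τ₀ →
          4 * κ * ((n : ℝ) * lag) ≤ δ * (τ₀ * ((N + 1 : ℕ) : ℝ) ^ (-(1 / 3 : ℝ))) →
          ∫⁻ z, ENNReal.ofReal (Real.exp (2 * ((n : ℝ)⁻¹ * ∑ j : Fin n, ∑ i, φ (Φ.flow ((((j : ℕ) : ℝ) + 1) * lag) z i).1 * g ((Real.sqrt θ)⁻¹ • ((Φ.flow ((((j : ℕ) : ℝ) + 1) * lag) z i).2 - u₀))))) ∂(localGibbsLaw σ (fun _ => a) (fun _ => u₀) (fun _ => θ) N Φ) ≤ ENNReal.ofReal (Real.exp (δ * (N + 1))) →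
          ∃ W : Config (N + 1) (Fin 3) T3 → ℝ, Measurable W ∧ (∃ C : ℝ, ∀ z, |W z| ≤ C) ∧
            ∫⁻ z, ENNReal.ofReal (Real.exp (2 * ((∑ i, φ (z i).1 * g ((Real.sqrt θ)⁻¹ • ((z i).2 - u₀))) -
                lag⁻¹ * (W (Φ.flow lag z) - W z)))) ∂(localGibbsLaw σ (fun _ => a) (fun _ => u₀) (fun _ => θ) N Φ)
              ≤ ENNReal.ofReal (Real.exp (δ * (N + 1))) ∧
            ∫⁻ z, ENNReal.ofReal (Real.exp (4 * (τ₀ * ((N + 1 : ℕ) : ℝ) ^ (-(1 / 3 : ℝ)))⁻¹ * |W z|)) ∂(localGibbsLaw σ (fun _ => a) (fun _ => u₀) (fun _ => θ) N Φ)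
              ≤ ENNReal.ofReal (Real.exp (δ * (N + 1))) := by
  intro σ a θ u₀ _hσ hσ2 ha hθ N Φ φ g κ hφ hg hφ1 hgκ n lag δ τ₀ hn hlag hτ₀ hcost hmom
  haveI : IsProbabilityMeasure (localGibbsLaw σ (fun _ => a) (fun _ => u₀) (fun _ => θ) N Φ) :=
    isProbabilityMeasure_localGibbsLaw continuous_const continuous_const continuous_const
      (fun _ => ha) (fun _ => hθ) hσ2 N Φ
  -- the good set is `G_N`-conull (`G_N ≪ liouville`)
  have hgood : ∀ᵐ z ∂(localGibbsLaw σ (fun _ => a) (fun _ => u₀) (fun _ => θ) N Φ), z ∈ Φ.good := by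
    rw [localGibbsLaw_eq]
    exact (localGibbsMeasure_absolutelyContinuous σ _ _ _ N Φ).ae_le Φ.ae_mem_good
  -- the one-body observable is measurable and bounded by `(N+1)κ`
  have hgc : Continuous fun v : V3 => g ((Real.sqrt θ)⁻¹ • (v - u₀)) := by fun_prop
  have hFm : Measurable fun z : Config (N + 1) (Fin 3) T3 =>
      ∑ i, φ (z i).1 * g ((Real.sqrt θ)⁻¹ • ((z i).2 - u₀)) :=
    Finset.measurable_sum _ fun i _ =>
      (hφ.measurable.comp (measurable_pi_apply i).fst).mul
        (hgc.measurable.comp (measurable_pi_apply i).snd)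
  have hFK : ∀ z : Config (N + 1) (Fin 3) T3,
      |∑ i, φ (z i).1 * g ((Real.sqrt θ)⁻¹ • ((z i).2 - u₀))| ≤ ((N : ℝ) + 1) * κ := by
    intro z
    calc |∑ i, φ (z i).1 * g ((Real.sqrt θ)⁻¹ • ((z i).2 - u₀))|
        ≤ ∑ i, |φ (z i).1 * g ((Real.sqrt θ)⁻¹ • ((z i).2 - u₀))| := Finset.abs_sum_le_sum_abs _ _
      _ ≤ ∑ _i : Fin (N + 1), κ := Finset.sum_le_sum fun i _ => by
          rw [abs_mul]
          calc |φ (z i).1| * |g ((Real.sqrt θ)⁻¹ • ((z i).2 - u₀))| ≤ 1 * κ :=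
                mul_le_mul (hφ1 _) (hgκ _) (abs_nonneg _) zero_le_one
            _ = κ := one_mul κ
      _ = ((N : ℝ) + 1) * κ := by
          simp only [Finset.sum_const, Finset.card_univ, Fintype.card_fin, nsmul_eq_mul, Nat.cast_add,
            Nat.cast_one]
  have hℓ : 0 < τ₀ * ((N + 1 : ℕ) : ℝ) ^ (-(1 / 3 : ℝ)) :=
    mul_pos hτ₀ (Real.rpow_pos_of_pos (Nat.cast_pos.mpr (Nat.succ_pos N)) _)
  have hcost' : 4 * (((N : ℝ) + 1) * κ) * ((n : ℝ) * lag) ≤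
      δ * ((N : ℝ) + 1) * (τ₀ * ((N + 1 : ℕ) : ℝ) ^ (-(1 / 3 : ℝ))) := by
    have hN : (0 : ℝ) ≤ (N : ℝ) + 1 := by positivity
    calc 4 * (((N : ℝ) + 1) * κ) * ((n : ℝ) * lag) = ((N : ℝ) + 1) * (4 * κ * ((n : ℝ) * lag)) := by ring
      _ ≤ ((N : ℝ) + 1) * (δ * (τ₀ * ((N + 1 : ℕ) : ℝ) ^ (-(1 / 3 : ℝ)))) :=
          mul_le_mul_of_nonneg_left hcost hN
      _ = δ * ((N : ℝ) + 1) * (τ₀ * ((N + 1 : ℕ) : ℝ) ^ (-(1 / 3 : ℝ))) := by ring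
  exact discreteFejer_of_window Φ.flow Φ.measurable_flow Φ.good Φ.flow_zero Φ.flow_add _ hgood _
    hFm hFK hn hlag hℓ hcost' hmom

end Summit.AtomisticToContinuum.HydrodynamicLimit.Theorems.KineticEntropyCollisionBudget

end
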